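import Literature.Analysis.FluidPDE.PlanarGeneratorAssembly
import Literature.Analysis.FluidPDE.PlanarGateTemplate2
import Literature.Analysis.FluidPDE.PlanarRedescription2
import HarnessLib

/-!
# Generator assembly, second layer: slot lists of second-layer phases and the abstract package

Topic `Literature/Analysis/FluidPDE`. `PlanarGeneratorAssembly.lean` glues a checked slot list of
first-layer phases into a generating move and proves `acm_compatible_blocks` from slot data for both
generators. This file (i) does the same gluing for slot lists of SECOND-LAYER phases (`Slot2`, whose
phases may contain sheared diagonal graph bands — the slot test reads the geometric checks on the
proxy, the junction and gate checks on the material view, `PlanarJunctionAgreement2.lean`,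
`PlanarGateTemplate2.lean`, the link test uses `redescribeB2` of `PlanarRedescription2.lean`), and
(ii) abstracts what the final theorem needs from ONE generator into a package `GenPack` (the glued
move, the head and last phases as checked first-layer phases, and the glued scalar at `t = 0, 1`),
built either from a first-layer slot list (`GenPack.ofSlots`) or from a second-layer slot list
whose head and last phases have no sheared node (`GenPack.ofSlots2`); `acm_compatible_blocks_of_packs`
is `acm_compatible_blocks_of_slots` with packs (so the straight generator can keep its landed
first-layer slots while the bent generator uses second-layer slots).

Folklore; no named facts. Infrastructure towards a discharge of `acm_compatible_blocks`
(`QuasiSelfSimilarCompatibleBlocks.lean`).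

## References

* G. Alberti, G. Crippa, A. L. Mazzucato, *Exponential self-similar mixing by incompressible
  flows*, J. Amer. Math. Soc. 32 (2019), 445–490, §§7–8 (arXiv:1605.02090).
-/

noncomputable section

open Function Set Filter
open scoped Topology ContDiff

namespace Literature.Analysis.FluidPDE

namespace PlanarKinematics

open Gluing QuasiSelfSimilar FunctionSpaces FunctionSpaces.Torus

/-- The plane `ℝ²` as a Euclidean space. [folklore] -/
local notation "E²" => EuclideanSpace ℝ (Fin 2)

/-! ## Dependence on time through the clock only (second layer) -/

namespace ElemQ2

/-- The scalar of a second-layer element depends on time only through the clock. [folklore] -/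
theorem scalar_congr_clock (e : ElemQ2) {t₀ τ : ℝ} (G : ℝ → ℝ) {t t' : ℝ} (h : clock t₀ τ t = clock t₀ τ t') (z : E²) :
    e.scalar t₀ τ G t z = e.scalar t₀ τ G t' z := by
  cases e with
  | base b => simp only [scalar_base, ElemQ.scalar_frame, h]
  | sdg s =>
    simp only [scalar_sdg, SDgQ.scalar, LinFrame.conjScalar_apply, shCornerScalar, shGraphPullback_apply, vec2_apply_one,
      Pw.cdu, h]

end ElemQ2

namespace PhaseQ2

variable (P : PhaseQ2)

/-- The cut-offs at two times with the same clock value agree. [folklore] -/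
theorem chi_congr_clock (P : PhaseQ2) {t t' : ℝ} (h : clock P.T0 P.Tau t = clock P.T0 P.Tau t') (k : ℕ) (z : E²) :
    P.chain.chi k t z = P.chain.chi k t' z :=
  PhaseQ.chi_congr_clock (P := P.geoPhase) h k z

/-- The element scalars at two times with the same clock value agree. [folklore] -/
theorem Θ_congr_clock (P : PhaseQ2) (G : ℝ → ℝ) {t t' : ℝ} (h : clock P.T0 P.Tau t = clock P.T0 P.Tau t') (k : ℕ) (z : E²) :
    P.Θ G k t z = P.Θ G k t' z := by
  simp only [PhaseQ2.Θ]; exact (P.node k).e.scalar_congr_clock G h z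

/-- **The assembled scalar depends on time only through the clock.** [folklore] -/
theorem scalar_congr_clock (P : PhaseQ2) (G : ℝ → ℝ) {t t' : ℝ} (h : clock P.T0 P.Tau t = clock P.T0 P.Tau t') :
    P.scalar G t = P.scalar G t' := by
  funext z
  rw [PhaseQ2.scalar, assembledScalar_apply, assembledScalar_apply]
  exact Finset.sum_congr rfl fun k _ => by rw [P.chi_congr_clock h, P.Θ_congr_clock G h]

/-- The assembled scalar before the clock window. [folklore] -/
theorem scalar_of_le (P : PhaseQ2) (G : ℝ → ℝ) (hτ : 0 < P.τ) {t : ℝ} (ht : t ≤ (P.t₀ : ℝ) + P.τ / 3) :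
    P.scalar G t = P.scalar G P.t₀ := by
  have hτ' : (0 : ℝ) < P.τ := by exact_mod_cast hτ
  apply P.scalar_congr_clock
  rw [show P.T0 = (P.t₀ : ℝ) from rfl, show P.Tau = (P.τ : ℝ) from rfl, clock_of_le hτ' ht, clock_start hτ']

/-- The assembled scalar after the clock window. [folklore] -/
theorem scalar_of_ge (P : PhaseQ2) (G : ℝ → ℝ) (hτ : 0 < P.τ) {t : ℝ} (ht : (P.t₀ : ℝ) + 2 * P.τ / 3 ≤ t) :
    P.scalar G t = P.scalar G (P.t₀ + P.τ) := by
  have hτ' : (0 : ℝ) < P.τ := by exact_mod_cast hτ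
  apply P.scalar_congr_clock
  rw [show P.T0 = (P.t₀ : ℝ) from rfl, show P.Tau = (P.τ : ℝ) from rfl, clock_of_ge hτ' ht, clock_end hτ']

/-- The assembled velocity vanishes before the clock window. [folklore] -/
theorem velocity_of_lt (P : PhaseQ2) (hτ : 0 < P.τ) {t : ℝ} (ht : t < (P.t₀ : ℝ) + P.τ / 3) : P.velocity t = 0 := by
  have hτ' : (0 : ℝ) < P.τ := by exact_mod_cast hτ
  funext z
  exact P.velocity_eq_zero_of_clockDeriv (clockDeriv_of_lt hτ' ht) z

/-- The assembled velocity vanishes after the clock window. [folklore] -/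
theorem velocity_of_gt (P : PhaseQ2) (hτ : 0 < P.τ) {t : ℝ} (ht : (P.t₀ : ℝ) + 2 * P.τ / 3 < t) : P.velocity t = 0 := by
  have hτ' : (0 : ℝ) < P.τ := by exact_mod_cast hτ
  funext z
  exact P.velocity_eq_zero_of_clockDeriv (clockDeriv_of_gt hτ' ht) z

/-! ### Phases without sheared nodes are their material view -/

/-- **No sheared node.** [folklore] -/
def allBaseB (P : PhaseQ2) : Bool := P.nodes.all fun n => !n.e.isSheared

variable {P}

/-- A node list without sheared nodes has equal proxy and material views. [folklore] -/
theorem map_geo_eq_map_toNode : ∀ (ns : List NodeQ2), (ns.all fun n => !n.e.isSheared) = true →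
    ns.map NodeQ2.geo = ns.map NodeQ2.toNode := by
  intro ns
  induction ns with
  | nil => intro _; rfl
  | cons n rest ih =>
    intro h
    simp only [List.all_cons, Bool.and_eq_true, Bool.not_eq_true'] at h
    rw [List.map_cons, List.map_cons, ih h.2]
    congr 1
    obtain ⟨e, box, step, ann⟩ := n
    cases e with
    | base b => rfl
    | sdg s => simp [ElemQ2.isSheared] at h

/-- **Without sheared nodes the proxy is the material view.** [folklore] -/
theorem geoPhase_eq_toPhase (h : P.allBaseB = true) : P.geoPhase = P.toPhase := by
  simp only [geoPhase, toPhase, map_geo_eq_map_toNode P.nodes h]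

/-- Without sheared nodes every element scalar is that of the material view. [folklore] -/
theorem Θ_eq_toPhase_Θ (h : P.allBaseB = true) (G : ℝ → ℝ) (k : ℕ) : P.Θ G k = P.toPhase.Θ G k := by
  rw [toPhase_Θ]
  simp only [PhaseQ2.Θ]
  by_cases hk : k < P.K
  · have hmem := P.node_mem hk
    have hall := List.all_eq_true.1 h _ hmem
    simp only [Bool.not_eq_true'] at hall
    exact ElemQ2.scalar_eq_toElemQ_of_not_isSheared hall _ _ G
  · have hnode : P.node k = default := by
      rw [node, List.getD_eq_getElem?_getD, List.getElem?_eq_none (by simpa [K] using hk)]; rfl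
    rw [hnode]; rfl

/-- **Without sheared nodes the assembled scalar is that of the material view.** [folklore] -/
theorem scalar_eq_toPhase_scalar (h : P.allBaseB = true) (G : ℝ → ℝ) : P.scalar G = P.toPhase.scalar G := by
  funext t z
  rw [PhaseQ2.scalar, PhaseQ.scalar, assembledScalar_apply, assembledScalar_apply]
  have hc : P.chain = P.toPhase.chain := by
    show P.geoPhase.chain = _; rw [geoPhase_eq_toPhase h]
  rw [hc]
  exact Finset.sum_congr rfl fun k _ => by rw [Θ_eq_toPhase_Θ h G k]

/-- The junction check of the material view from the second-layer junction check. [folklore] -/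
theorem agreeB_toPhase_of_agreeB2 (h : P.agreeB2 = true) : P.toPhase.agreeB = true := by
  simp only [agreeB2, Bool.and_eq_true] at h; exact h.1

end PhaseQ2

/-! ## Slots of second-layer phases -/

/-- **A slot of a second-layer phase.** [folklore] -/
structure Slot2 where
  /-- the phase -/
  P : PhaseQ2
  /-- slot start -/
  a : ℚ
  /-- stub table -/
  stub : Fin 2 → Bool → Option ℕ
  /-- cover certificate of this phase's end by the next phase's start -/
  rc : List (Fin 2 × List (ℕ × EquivCert2))
  /-- cover certificate of the next phase's start by this phase's end -/
  rc' : List (Fin 2 × List (ℕ × EquivCert2))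

namespace Slot2

/-- **Slot test** (second layer). [folklore] -/
def okB (s : Slot2) (C : GateC) (gate : Fin 2 → Bool → Bool) (r : ℚ) : Bool :=
  s.P.geoPhase.geomB && s.P.geoPhase.boxSepB && s.P.agreeB2 && s.P.toPhase.gateOKB C s.stub s.a && decide (s.P.r₀ = r) &&
    decide (∀ k sd, PhaseQ.gateOf s.stub k sd = gate k sd) && s.P.elemsValidB

/-- **Link test** (second layer). [folklore] -/
def linkB (s s' : Slot2) : Bool :=
  PhaseQ2.redescribeB2 s.P true s'.P false s.rc s.rc' && decide (s.P.t₀ + 2 * s.P.τ / 3 < s'.a) &&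
    decide (s'.a < s'.P.t₀ + s'.P.τ / 3) && decide (s.a ≤ s'.a)

end Slot2

/-- **Slot list test** (second layer). [folklore] -/
def slotsOKB2 (C : GateC) (gate : Fin 2 → Bool → Bool) (r : ℚ) : List Slot2 → Bool
  | [] => false
  | [s] => s.okB C gate r
  | s :: s' :: rest => s.okB C gate r && Slot2.linkB s s' && slotsOKB2 C gate r (s' :: rest)

/-- **The glued velocity.** [folklore] -/
def gluedV2 : List Slot2 → ℝ → E² → E²
  | [] => fun _ _ => 0
  | [s] => s.P.velocity
  | s :: s' :: rest => timeGlue (s'.a : ℝ) s.P.velocity (gluedV2 (s' :: rest))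

/-- **The glued scalar.** [folklore] -/
def gluedΘ2 (G : ℝ → ℝ) : List Slot2 → ℝ → E² → ℝ
  | [] => fun _ _ => 0
  | [s] => s.P.scalar G
  | s :: s' :: rest => timeGlue (s'.a : ℝ) (s.P.scalar G) (gluedΘ2 G (s' :: rest))

/-- The slot start of the head. [folklore] -/
def headA2 : List Slot2 → ℚ
  | [] => 0
  | s :: _ => s.a

/-- The phase of the head. [folklore] -/
def headP2 : List Slot2 → PhaseQ2
  | [] => default
  | s :: _ => s.P

/-- The phase of the last slot. [folklore] -/
def lastP2 : List Slot2 → PhaseQ2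
  | [] => default
  | [s] => s.P
  | _ :: s' :: rest => lastP2 (s' :: rest)

section Glue2

variable {C : GateC} {gate : Fin 2 → Bool → Bool} {r : ℚ} {G : ℝ → ℝ}

/-- Unpacking the slot test. [folklore] -/
theorem Slot2.okB_iff (s : Slot2) : s.okB C gate r = true ↔
    s.P.geoPhase.geomB = true ∧ s.P.geoPhase.boxSepB = true ∧ s.P.agreeB2 = true ∧ s.P.toPhase.gateOKB C s.stub s.a = true ∧
      s.P.r₀ = r ∧ PhaseQ.gateOf s.stub = gate ∧ s.P.elemsValidB = true := by
  simp only [Slot2.okB, Bool.and_eq_true, decide_eq_true_eq, and_assoc]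
  constructor
  · rintro ⟨h1, h2, h3, h4, h5, h6, h7⟩; exact ⟨h1, h2, h3, h4, h5, funext fun k => funext fun sd => h6 k sd, h7⟩
  · rintro ⟨h1, h2, h3, h4, h5, h6, h7⟩; exact ⟨h1, h2, h3, h4, h5, fun k sd => by rw [h6], h7⟩

/-- The profile hypotheses for a second-layer phase with radius `r`. [folklore] -/
theorem ProfileOK.hyp2 (h : ProfileOK G r) {P : PhaseQ2} (hr : P.r₀ = r) : PhaseQ.ProfileHyp G 10 P.r₀ :=
  ⟨h.smooth, h.bound, by norm_num, by rw [hr]; exact h.supp, h.even⟩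

/-- **A single checked slot is a generator move on `[a, ∞)`.** [folklore] -/
theorem Slot2.isGeneratorMoveOn (hG : ProfileOK G r) {s : Slot2} (h : s.okB C gate r = true) :
    IsGeneratorMoveOn (Ici (s.a : ℝ)) s.P.velocity (s.P.scalar G) gate C.VgT (C.ΘgT G) C.δ := by
  obtain ⟨hg, hsep, ha, hgate, hr, hgt, hv⟩ := s.okB_iff.1 h
  rw [← hgt]
  exact PhaseQ2.isGeneratorMoveOn_of_checks2 hG.smooth hG.bound (by rw [hr]; exact hG.supp) hG.even hv hg hsep ha hgate

/-- The head of a checked slot list passes the slot test. [folklore] -/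
theorem okB_head_of_slotsOKB2 {s : Slot2} {rest : List Slot2} (h : slotsOKB2 C gate r (s :: rest) = true) :
    s.okB C gate r = true := by
  cases rest with
  | nil => exact h
  | cons s' rest => simp only [slotsOKB2, Bool.and_eq_true] at h; exact h.1.1

/-- **The glued fields of a checked list are those of the head before the head's clock saturates.** [folklore] -/
theorem glued_eq_head2 {s : Slot2} {rest : List Slot2} (h : slotsOKB2 C gate r (s :: rest) = true) {t : ℝ}
    (ht : t ≤ (s.P.t₀ : ℝ) + 2 * s.P.τ / 3) :
    gluedV2 (s :: rest) t = s.P.velocity t ∧ gluedΘ2 G (s :: rest) t = s.P.scalar G t := by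
  cases rest with
  | nil => exact ⟨rfl, rfl⟩
  | cons s' rest =>
    simp only [slotsOKB2, Bool.and_eq_true, Slot2.linkB, decide_eq_true_eq] at h
    obtain ⟨⟨-, ⟨⟨-, h1⟩, -⟩, -⟩, -⟩ := h
    have h1' : (s.P.t₀ : ℝ) + 2 * s.P.τ / 3 < s'.a := by exact_mod_cast h1
    exact ⟨timeGlue_of_le _ _ (by linarith), timeGlue_of_le _ _ (by linarith)⟩

/-- **Gluing a checked slot list**: a generator move on `[a_head, ∞)`. [folklore] -/
theorem isGeneratorMoveOn_glued2 (hG : ProfileOK G r) :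
    ∀ (L : List Slot2), slotsOKB2 C gate r L = true →
      IsGeneratorMoveOn (Ici (headA2 L : ℝ)) (gluedV2 L) (gluedΘ2 G L) gate C.VgT (C.ΘgT G) C.δ := by
  intro L
  induction L with
  | nil => intro h; exact absurd h (by simp [slotsOKB2])
  | cons s rest ih =>
    cases rest with
    | nil => intro h; exact Slot2.isGeneratorMoveOn hG h
    | cons s' rest =>
      intro h
      have hfull := h
      simp only [slotsOKB2, Bool.and_eq_true] at h
      obtain ⟨⟨hs, hlink⟩, hrest⟩ := h
      have h₁ := Slot2.isGeneratorMoveOn hG hs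
      have h₂ := ih hrest
      simp only [headA2] at h₂ ⊢
      simp only [Slot2.linkB, Bool.and_eq_true, decide_eq_true_eq] at hlink
      obtain ⟨⟨⟨hred, hb1⟩, hb2⟩, hab⟩ := hlink
      obtain ⟨hg, hsep, ha, -, hr, -, hv⟩ := s.okB_iff.1 hs
      obtain ⟨hg', hsep', ha', -, hr', -, hv'⟩ := s'.okB_iff.1 (okB_head_of_slotsOKB2 hrest)
      have hτ := PhaseQ2.τ_pos_of_geomB2 hg
      have hτ' := PhaseQ2.τ_pos_of_geomB2 hg'
      have hτr : (0 : ℝ) < s.P.τ := by exact_mod_cast hτ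
      have hτr' : (0 : ℝ) < s'.P.τ := by exact_mod_cast hτ'
      have hb1' : (s.P.t₀ : ℝ) + 2 * s.P.τ / 3 < s'.a := by exact_mod_cast hb1
      have hb2' : (s'.a : ℝ) < s'.P.t₀ + s'.P.τ / 3 := by exact_mod_cast hb2
      set ε : ℝ := min ((s'.a : ℝ) - (s.P.t₀ + 2 * s.P.τ / 3)) ((s'.P.t₀ : ℝ) + s'.P.τ / 3 - s'.a) with hε
      have hεpos : 0 < ε := lt_min (by linarith) (by linarith)
      have hwin : ∀ t ∈ Ioo ((s'.a : ℝ) - ε) (s'.a + ε),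
          (s.P.t₀ : ℝ) + 2 * s.P.τ / 3 < t ∧ t < (s'.P.t₀ : ℝ) + s'.P.τ / 3 := fun t ht => by
        have e1 : ε ≤ (s'.a : ℝ) - (s.P.t₀ + 2 * s.P.τ / 3) := min_le_left _ _
        have e2 : ε ≤ (s'.P.t₀ : ℝ) + s'.P.τ / 3 - s'.a := min_le_right _ _
        exact ⟨by linarith [ht.1], by linarith [ht.2]⟩
      have hagree : ∀ t ∈ Ioo ((s'.a : ℝ) - ε) (s'.a + ε),
          s.P.scalar G t = s'.P.scalar G t ∧ s.P.velocity t = s'.P.velocity t := fun t ht => by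
        obtain ⟨h1, h2⟩ := hwin t ht
        exact PhaseQ2.fields_eq_of_redescribeB2 (hG.hyp2 hr) (hG.hyp2 hr') hv hg hsep
          (PhaseQ2.scalar_juncCut_of_agreeB2 hG.even ha hv) hv' hg' hsep' (PhaseQ2.scalar_juncCut_of_agreeB2 hG.even ha' hv')
          hred
          (by show clock s.P.T0 s.P.Tau t = endVal true; simp only [endVal, if_true]; exact clock_of_ge hτr h1.le)
          (by show clock s'.P.T0 s'.P.Tau t = endVal false; simp only [endVal]; exact clock_of_le hτr' h2.le)
          (clockDeriv_of_gt hτr h1) (clockDeriv_of_lt hτr' h2)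
      have htail : ∀ t ∈ Ioo ((s'.a : ℝ) - ε) (s'.a + ε),
          gluedV2 (s' :: rest) t = s'.P.velocity t ∧ gluedΘ2 G (s' :: rest) t = s'.P.scalar G t := fun t ht =>
        glued_eq_head2 hrest (by linarith [(hwin t ht).2, hτr'])
      have hV : ∀ t ∈ Ioo ((s'.a : ℝ) - ε) (s'.a + ε), s.P.velocity t = gluedV2 (s' :: rest) t := fun t ht => by
        rw [(htail t ht).1, (hagree t ht).2]
      have hΘ : ∀ t ∈ Ioo ((s'.a : ℝ) - ε) (s'.a + ε), s.P.scalar G t = gluedΘ2 G (s' :: rest) t := fun t ht => by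
        rw [(htail t ht).2, (hagree t ht).1]
      have hab' : (s.a : ℝ) ≤ s'.a := by exact_mod_cast hab
      exact (h₁.glue hεpos h₂ hV hΘ).mono fun t (ht : (s.a : ℝ) ≤ t) =>
        ⟨fun _ => ht, fun htb => (le_of_lt htb : (s'.a : ℝ) ≤ t)⟩

end Glue2

/-! ## End conditions and the glued move of a second-layer slot list -/

/-- All glue times below `c`. [folklore] -/
def tailAllLtB2 (c : ℚ) : List Slot2 → Bool
  | [] => true
  | _ :: rest => rest.all fun s => decide (s.a < c)

/-- **End conditions** (second layer). [folklore] -/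
def endsOKB2 (L : List Slot2) : Bool :=
  decide (headA2 L ≤ 0) && decide (0 ≤ (headP2 L).t₀) && tailAllLtB2 1 L &&
    decide ((lastP2 L).t₀ + 2 * (lastP2 L).τ / 3 < 1)

section Ends2

variable {C : GateC} {gate : Fin 2 → Bool → Bool} {r : ℚ} {G : ℝ → ℝ}

/-- The last slot of a checked list passes the slot test. [folklore] -/
theorem okB_last_of_slotsOKB2 : ∀ (L : List Slot2), slotsOKB2 C gate r L = true →
    (lastP2 L).geoPhase.geomB = true ∧ (lastP2 L).geoPhase.boxSepB = true ∧ (lastP2 L).agreeB2 = true ∧ (lastP2 L).r₀ = r ∧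
      (lastP2 L).elemsValidB = true := by
  intro L
  induction L with
  | nil => intro h; exact absurd h (by simp [slotsOKB2])
  | cons s rest ih =>
    cases rest with
    | nil =>
      intro h
      obtain ⟨hg, hsep, ha, -, hr, -, hv⟩ := s.okB_iff.1 h
      exact ⟨hg, hsep, ha, hr, hv⟩
    | cons s' rest =>
      intro h
      simp only [slotsOKB2, Bool.and_eq_true] at h
      exact ih h.2

/-- **After all glue times the glued fields are those of the last phase.** [folklore] -/
theorem glued_eq_last2 {c : ℚ} : ∀ (L : List Slot2), L ≠ [] → tailAllLtB2 c L = true → ∀ t : ℝ, (c : ℝ) ≤ t →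
    gluedV2 L t = (lastP2 L).velocity t ∧ gluedΘ2 G L t = (lastP2 L).scalar G t := by
  intro L
  induction L with
  | nil => intro h; exact absurd rfl h
  | cons s rest ih =>
    cases rest with
    | nil => intro _ _ t _; exact ⟨rfl, rfl⟩
    | cons s' rest =>
      intro _ h t ht
      simp only [tailAllLtB2, List.all_cons, Bool.and_eq_true, decide_eq_true_eq] at h
      have h1 : (s'.a : ℝ) < t := lt_of_lt_of_le (by exact_mod_cast h.1) ht
      have ih' := ih (List.cons_ne_nil _ _) (by simpa [tailAllLtB2] using h.2) t ht
      simp only [gluedV2, gluedΘ2, lastP2]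
      rw [timeGlue_of_lt _ _ h1, timeGlue_of_lt _ _ h1]
      exact ih'

/-- A checked slot list is nonempty. [folklore] -/
theorem ne_nil_of_slotsOKB2 {L : List Slot2} (h : slotsOKB2 C gate r L = true) : L ≠ [] := by
  rintro rfl; simp [slotsOKB2] at h

/-- The head phase of a checked slot list passes its checks. [folklore] -/
theorem head_facts_of_slotsOKB2 {L : List Slot2} (h : slotsOKB2 C gate r L = true) :
    (headP2 L).geoPhase.geomB = true ∧ (headP2 L).geoPhase.boxSepB = true ∧ (headP2 L).agreeB2 = true ∧ (headP2 L).r₀ = r ∧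
      (headP2 L).elemsValidB = true := by
  cases L with
  | nil => exact absurd h (by simp [slotsOKB2])
  | cons s rest =>
    obtain ⟨hg, hsep, ha, -, hr, -, hv⟩ := s.okB_iff.1 (okB_head_of_slotsOKB2 h)
    exact ⟨hg, hsep, ha, hr, hv⟩

/-- **The glued fields at times `≤ 0`.** [folklore] -/
theorem glued_of_nonpos2 {L : List Slot2} (hL : slotsOKB2 C gate r L = true) (hE : endsOKB2 L = true) {t : ℝ} (ht : t ≤ 0) :
    gluedV2 L t = 0 ∧ gluedΘ2 G L t = (headP2 L).scalar G (headP2 L).t₀ := by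
  cases L with
  | nil => exact absurd hL (by simp [slotsOKB2])
  | cons s rest =>
    simp only [endsOKB2, Bool.and_eq_true, decide_eq_true_eq, headA2, headP2] at hE
    obtain ⟨⟨⟨-, h0⟩, -⟩, -⟩ := hE
    have hg := (s.okB_iff.1 (okB_head_of_slotsOKB2 hL)).1
    have hτ := PhaseQ2.τ_pos_of_geomB2 hg
    have hτr : (0 : ℝ) < s.P.τ := by exact_mod_cast hτ
    have h0' : (0 : ℝ) ≤ s.P.t₀ := by exact_mod_cast h0
    obtain ⟨hV, hΘ⟩ := glued_eq_head2 (G := G) hL (t := t) (by linarith)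
    simp only [headP2]
    rw [hV, hΘ, s.P.velocity_of_lt hτ (by linarith), s.P.scalar_of_le G hτ (by linarith)]
    exact ⟨rfl, rfl⟩

/-- **The glued fields at times `≥ 1`.** [folklore] -/
theorem glued_of_one_le2 {L : List Slot2} (hL : slotsOKB2 C gate r L = true) (hE : endsOKB2 L = true) {t : ℝ} (ht : 1 ≤ t) :
    gluedV2 L t = 0 ∧ gluedΘ2 G L t = (lastP2 L).scalar G ((lastP2 L).t₀ + (lastP2 L).τ) := by
  simp only [endsOKB2, Bool.and_eq_true, decide_eq_true_eq] at hE
  obtain ⟨⟨-, htail⟩, h1⟩ := hE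
  have hg := (okB_last_of_slotsOKB2 L hL).1
  have hτ := PhaseQ2.τ_pos_of_geomB2 hg
  have h1' : ((lastP2 L).t₀ : ℝ) + 2 * (lastP2 L).τ / 3 < 1 := by exact_mod_cast h1
  obtain ⟨hV, hΘ⟩ := glued_eq_last2 (G := G) L (ne_nil_of_slotsOKB2 hL) htail t (by exact_mod_cast ht)
  rw [hV, hΘ, (lastP2 L).velocity_of_gt hτ (by linarith), (lastP2 L).scalar_of_ge G hτ (by linarith)]
  exact ⟨rfl, rfl⟩

/-- **The glued move of a checked second-layer slot list with end conditions is a generator move.**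
[folklore] -/
theorem isGeneratorMove_glued2 (hG : ProfileOK G r) (hC : C.validB = true) (hC0 : 0 ≤ C.t₀) (hC1 : C.t₀ + 2 * C.τ / 3 < 1)
    {L : List Slot2} (hL : slotsOKB2 C gate r L = true) (hE : endsOKB2 L = true) :
    IsGeneratorMove (gluedV2 L) (gluedΘ2 G L) gate C.VgT (C.ΘgT G) C.δ := by
  have hon := isGeneratorMoveOn_glued2 hG L hL
  have hE' := hE
  simp only [endsOKB2, Bool.and_eq_true, decide_eq_true_eq] at hE'
  obtain ⟨⟨⟨ha, -⟩, -⟩, -⟩ := hE'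
  have ha' : (headA2 L : ℝ) ≤ 0 := by exact_mod_cast ha
  have hτC := GateC.τ_pos hC
  have hC0' : (0 : ℝ) ≤ C.t₀ := by exact_mod_cast hC0
  have hC1' : (C.t₀ : ℝ) + 2 * C.τ / 3 < 1 := by exact_mod_cast hC1
  refine (hon.mono fun t ht => le_trans ha' ht.1).toMove_of_static ?_ ?_ ?_ ?_ ?_ ?_ ?_ ?_
  · intro t ht; rw [(glued_of_nonpos2 (G := G) hL hE ht).1, (glued_of_nonpos2 (G := G) hL hE le_rfl).1]
  · intro t ht; rw [(glued_of_nonpos2 hL hE ht).2, (glued_of_nonpos2 hL hE le_rfl).2]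
  · intro t ht; rw [(glued_of_one_le2 (G := G) hL hE ht).1, (glued_of_one_le2 (G := G) hL hE le_rfl).1]
  · intro t ht; rw [(glued_of_one_le2 hL hE ht).2, (glued_of_one_le2 hL hE le_rfl).2]
  · intro k t ht
    rw [GateC.VgT_of_lt hC k (by linarith), GateC.VgT_of_lt hC k (by linarith)]
  · intro k t ht
    exact GateC.ΘgT_congr_clock G k (by rw [clock_of_le hτC (by linarith), clock_of_le hτC (by linarith)])
  · intro k t ht
    rw [GateC.VgT_of_gt hC k (by linarith), GateC.VgT_of_gt hC k hC1']
  · intro k t ht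
    exact GateC.ΘgT_congr_clock G k (by rw [clock_of_ge hτC (by linarith), clock_of_ge hτC hC1'.le])

/-- **The glued scalar at `t = 0`.** [folklore] -/
theorem gluedΘ2_zero {L : List Slot2} (hL : slotsOKB2 C gate r L = true) (hE : endsOKB2 L = true) :
    gluedΘ2 G L 0 = (headP2 L).scalar G 0 ∧ clock (headP2 L).T0 (headP2 L).Tau 0 = 0 := by
  cases L with
  | nil => exact absurd hL (by simp [slotsOKB2])
  | cons s rest =>
    simp only [endsOKB2, Bool.and_eq_true, decide_eq_true_eq, headA2, headP2] at hE
    obtain ⟨⟨⟨-, h0⟩, -⟩, -⟩ := hE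
    have hg := (s.okB_iff.1 (okB_head_of_slotsOKB2 hL)).1
    have hτ := PhaseQ2.τ_pos_of_geomB2 hg
    have hτr : (0 : ℝ) < s.P.τ := by exact_mod_cast hτ
    have h0' : (0 : ℝ) ≤ s.P.t₀ := by exact_mod_cast h0
    refine ⟨(glued_eq_head2 (G := G) hL (t := 0) (by linarith)).2, ?_⟩
    show clock (s.P.t₀ : ℝ) (s.P.τ : ℝ) 0 = 0
    exact clock_of_le hτr (by linarith)

/-- **The glued scalar at `t = 1`.** [folklore] -/
theorem gluedΘ2_one {L : List Slot2} (hL : slotsOKB2 C gate r L = true) (hE : endsOKB2 L = true) :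
    gluedΘ2 G L 1 = (lastP2 L).scalar G 1 ∧ clock (lastP2 L).T0 (lastP2 L).Tau 1 = 1 := by
  have hE' := hE
  simp only [endsOKB2, Bool.and_eq_true, decide_eq_true_eq] at hE'
  obtain ⟨⟨-, htail⟩, h1⟩ := hE'
  have hg := (okB_last_of_slotsOKB2 L hL).1
  have hτ := PhaseQ2.τ_pos_of_geomB2 hg
  have hτr : (0 : ℝ) < (lastP2 L).τ := by exact_mod_cast hτ
  have h1' : ((lastP2 L).t₀ : ℝ) + 2 * (lastP2 L).τ / 3 < 1 := by exact_mod_cast h1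
  refine ⟨(glued_eq_last2 (G := G) L (ne_nil_of_slotsOKB2 hL) htail 1 (by norm_num)).2, ?_⟩
  show clock ((lastP2 L).t₀ : ℝ) ((lastP2 L).τ : ℝ) 1 = 1
  exact clock_of_ge hτr h1'.le

end Ends2

/-! ## The per-generator package and the final theorem from packages -/

/-- **Package of one generator**: the glued fields with their generator-move property, the head and
the last phases as first-layer phases passing their checks with radius `r`, and the identification of
the glued scalar at `t = 0` (head, clock `0`) and `t = 1` (last, clock `1`). [folklore] -/
structure GenPack (G : ℝ → ℝ) (C : GateC) (gate : Fin 2 → Bool → Bool) (r : ℚ) where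
  /-- glued velocity -/
  V : ℝ → E² → E²
  /-- glued scalar -/
  Θ : ℝ → E² → ℝ
  /-- head phase (first layer) -/
  Ph : PhaseQ
  /-- last phase (first layer) -/
  Pl : PhaseQ
  /-- the glued move is a generator move -/
  move : IsGeneratorMove V Θ gate C.VgT (C.ΘgT G) C.δ
  /-- checks of the head phase -/
  head_ok : Ph.geomB = true ∧ Ph.boxSepB = true ∧ Ph.agreeB = true ∧ Ph.r₀ = r
  /-- checks of the last phase -/
  last_ok : Pl.geomB = true ∧ Pl.boxSepB = true ∧ Pl.agreeB = true ∧ Pl.r₀ = r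
  /-- the glued scalar at `0` -/
  at_zero : Θ 0 = Ph.scalar G 0 ∧ clock Ph.T0 Ph.Tau 0 = 0
  /-- the glued scalar at `1` -/
  at_one : Θ 1 = Pl.scalar G 1 ∧ clock Pl.T0 Pl.Tau 1 = 1

namespace GenPack

variable {G : ℝ → ℝ} {C : GateC} {gate : Fin 2 → Bool → Bool} {r : ℚ}

/-- **Package of a first-layer slot list.** [folklore] -/
def ofSlots (hG : ProfileOK G r) (hC : C.validB = true) (hC0 : 0 ≤ C.t₀) (hC1 : C.t₀ + 2 * C.τ / 3 < 1) {L : List Slot}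
    (hL : slotsOKB C gate r L = true) (hE : endsOKB L = true) : GenPack G C gate r where
  V := gluedV L
  Θ := gluedΘ G L
  Ph := headP L
  Pl := lastP L
  move := isGeneratorMove_glued hG hC hC0 hC1 hL hE
  head_ok := head_facts_of_slotsOKB hL
  last_ok := okB_last_of_slotsOKB L hL
  at_zero := gluedΘ_zero hL hE
  at_one := gluedΘ_one hL hE

/-- **Package of a second-layer slot list** whose head and last phases have no sheared node. [folklore] -/
def ofSlots2 (hG : ProfileOK G r) (hC : C.validB = true) (hC0 : 0 ≤ C.t₀) (hC1 : C.t₀ + 2 * C.τ / 3 < 1) {L : List Slot2}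
    (hL : slotsOKB2 C gate r L = true) (hE : endsOKB2 L = true) (hh : (headP2 L).allBaseB = true) (hl : (lastP2 L).allBaseB = true) :
    GenPack G C gate r where
  V := gluedV2 L
  Θ := gluedΘ2 G L
  Ph := (headP2 L).toPhase
  Pl := (lastP2 L).toPhase
  move := isGeneratorMove_glued2 hG hC hC0 hC1 hL hE
  head_ok := by
    obtain ⟨hg, hsep, ha, hr, -⟩ := head_facts_of_slotsOKB2 hL
    rw [PhaseQ2.geoPhase_eq_toPhase hh] at hg hsep
    exact ⟨hg, hsep, PhaseQ2.agreeB_toPhase_of_agreeB2 ha, by simpa using hr⟩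
  last_ok := by
    obtain ⟨hg, hsep, ha, hr, -⟩ := okB_last_of_slotsOKB2 L hL
    rw [PhaseQ2.geoPhase_eq_toPhase hl] at hg hsep
    exact ⟨hg, hsep, PhaseQ2.agreeB_toPhase_of_agreeB2 ha, by simpa using hr⟩
  at_zero := by
    obtain ⟨h0, hc⟩ := gluedΘ2_zero (G := G) hL hE
    rw [PhaseQ2.scalar_eq_toPhase_scalar hh] at h0
    exact ⟨h0, hc⟩
  at_one := by
    obtain ⟨h1, hc⟩ := gluedΘ2_one (G := G) hL hE
    rw [PhaseQ2.scalar_eq_toPhase_scalar hl] at h1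
    exact ⟨h1, hc⟩

end GenPack

/-- **`acm_compatible_blocks` from per-generator packages** (the abstract form of
`acm_compatible_blocks_of_slots`: the straight generator may come from first-layer slots, the bent
one from second-layer slots). [folklore] -/
theorem acm_compatible_blocks_of_packs (C : GateC) (r : ℚ)
    {childGen : Gen → (Fin 2 → Fin 5) → Gen} {childSym : Gen → (Fin 2 → Fin 5) → SymmCode}
    (hT : IsSnakeTable childGen childSym) (hbent : ∃ p, childGen Gen.S p = Gen.B)
    (scert scert' : Gen → (Fin 2 → Fin 5) → List (Fin 2 × List (ℕ × EquivCert)))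
    (hC : C.globalB = true) (hr : 1 / 100 ≤ r ∧ r ≤ 1 / 2)
    (Pk : (g : Gen) → GenPack (channelProfile (r : ℝ)) C (genGate g) r)
    (hU : (Pk .S).Ph.uniformB 1 = true)
    (hsim : ∀ (g : Gen) (p : Fin 2 → Fin 5),
      (Pk g).Pl.simRedescribeB true (Pk (childGen g p)).Ph false (Simil.ofChild (childSym g p) p)
        (Simil.cellRect p) (scert g p) (scert' g p) = true) :
    acm_compatible_blocks := by
  have hG : ProfileOK (channelProfile (r : ℝ)) r := profileOK_channelProfile hr.1
  simp only [GateC.globalB, Bool.and_eq_true, decide_eq_true_eq] at hC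
  obtain ⟨⟨⟨hCv, hC0⟩, hC1⟩, hCδ⟩ := hC
  have hδ : (0 : ℝ) < C.δ := GateC.δ_pos hCv
  have hδ' : (C.δ : ℝ) ≤ 8⁻¹ := by
    have h := (Rat.cast_le (K := ℝ)).2 hCδ
    push_cast at h
    linarith
  have hr0 : (0 : ℝ) < r := by
    have h := (Rat.cast_le (K := ℝ)).2 hr.1
    push_cast at h
    linarith
  have hr2 : (r : ℝ) ≤ 2⁻¹ := by
    have h := (Rat.cast_le (K := ℝ)).2 hr.2
    push_cast at h
    linarith
  have hmove : ∀ g, IsGeneratorMove (Pk g).V (Pk g).Θ (genGate g) C.VgT (C.ΘgT (channelProfile (r : ℝ))) C.δ :=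
    fun g => (Pk g).move
  -- the straight block: normalisations from the uniform start
  have hS0 : ∀ z ∈ unitCube (Fin 2), (Pk .S).Θ 0 z = channelProfile (r : ℝ) (z 1 - 2⁻¹) := fun z hz => by
    obtain ⟨e0, hclk⟩ := (Pk .S).at_zero
    obtain ⟨hg, hsep, ha, hrS⟩ := (Pk .S).head_ok
    rw [e0, PhaseQ.scalar_of_uniformB hG hg hsep ha hrS hU one_pos hclk fun j => ⟨(hz j).1, (hz j).2.le⟩]
    simp
  obtain ⟨hm0, hm1⟩ := moments_of_channelProfile (Θ := (Pk .S).Θ) hr0 hr2 hS0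
  have hSb := (hmove .S).toBlock hm0 hm1
  refine acm_compatible_blocks_of_generator_moves (V₀ := fun g => (Pk g).V) (Θ₀ := fun g => (Pk g).Θ)
    hδ hδ' hSb (hmove .B) (GateC.isEquivariantGateField_template hG.even) hT hbent fun g p z hz => ?_
  obtain ⟨e1, hclk1⟩ := (Pk g).at_one
  obtain ⟨e0, hclk0⟩ := (Pk (childGen g p)).at_zero
  obtain ⟨hg, hsep, ha, hrg⟩ := (Pk g).last_ok
  obtain ⟨hg', hsep', ha', hrg'⟩ := (Pk (childGen g p)).head_ok
  have key := PhaseQ.selfSimilar_cell hG hg hsep ha hrg hg' hsep' ha' hrg' (hsim g p) hclk1 hclk0 hz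
  rw [SquareSymm.actScalar_apply] at key ⊢
  show (Pk g).Θ 1 z = (Pk (childGen g p)).Θ 0 _
  rw [e1, e0]
  exact key

/-! ## Chunked verification (second layer): the tests from bounded universal statements -/

namespace PhaseQ2

variable {P : PhaseQ2}

/-- **The junction test from its index form**: the material view's junction test and the shear
conditions junction by junction. [folklore] -/
theorem agreeB2_of_forall (h1 : P.toPhase.agreeB = true) (h2 : ∀ j < P.K, (!decide (j + 1 < P.K) || P.shJuncOKB j) = true) :
    P.agreeB2 = true := by
  simp only [agreeB2, h1, Bool.true_and]
  exact all_range_of_forall h2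

/-- **Validity from its index form.** [folklore] -/
theorem elemsValidB_of_forall {P : PhaseQ2} (hτ : 0 < P.τ) (h : ∀ k < P.K, (P.node k).e.validB = true) : P.elemsValidB = true := by
  simp only [elemsValidB, Bool.and_eq_true, List.all_eq_true, decide_eq_true_eq]
  refine ⟨fun n hn => ?_, hτ⟩
  obtain ⟨k, hk, rfl⟩ := List.getElem_of_mem hn
  have := h k (by simpa [K] using hk)
  simpa [node, List.getD_eq_getElem?_getD, List.getElem?_eq_getElem hk] using this

/-- **No sheared node, from its index form.** [folklore] -/
theorem allBaseB_of_forall (h : ∀ k < P.K, (P.node k).e.isSheared = false) : P.allBaseB = true := by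
  simp only [allBaseB, List.all_eq_true, Bool.not_eq_true']
  intro n hn
  obtain ⟨k, hk, rfl⟩ := List.getElem_of_mem hn
  have := h k (by simpa [K] using hk)
  simpa [node, List.getD_eq_getElem?_getD, List.getElem?_eq_getElem hk] using this

/-- **The re-description certificate from its index form** (second layer). [folklore] -/
theorem redescribeB2_of_forall {P' : PhaseQ2} {e e' : Bool} {cert cert' : List (Fin 2 × List (ℕ × EquivCert2))}
    (hs : P.geoPhase.sgnsOKB = true) (hs' : P'.geoPhase.sgnsOKB = true) (hm : P.geoPhase.middleInSqB e = true)
    (hm' : P'.geoPhase.middleInSqB e' = true) (hend : endNodesEq2B P e P' e' = true) (hl : cert.length = P.K) (hl' : cert'.length = P'.K)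
    (hc : ∀ k < P.K, coverEntry2B P e P' e' k (cert.getD k (0, [])) = true)
    (hc' : ∀ k' < P'.K, coverEntry2B P' e' P e k' (cert'.getD k' (0, [])) = true) :
    redescribeB2 P e P' e' cert cert' = true := by
  simp only [redescribeB2, hs, hs', hm, hm', hend, hl, hl', decide_true, Bool.true_and, Bool.and_eq_true]
  exact ⟨all_range_of_forall hc, all_range_of_forall hc'⟩

end PhaseQ2

/-- **The slot test from its parts** (second layer). [folklore] -/
theorem Slot2.okB_intro {C : GateC} {gate : Fin 2 → Bool → Bool} {r : ℚ} {s : Slot2} (hg : s.P.geoPhase.geomB = true)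
    (hsep : s.P.geoPhase.boxSepB = true) (ha : s.P.agreeB2 = true) (hgate : s.P.toPhase.gateOKB C s.stub s.a = true)
    (hr : s.P.r₀ = r) (hgt : ∀ k sd, PhaseQ.gateOf s.stub k sd = gate k sd) (hv : s.P.elemsValidB = true) :
    s.okB C gate r = true :=
  s.okB_iff.2 ⟨hg, hsep, ha, hgate, hr, funext fun k => funext fun sd => hgt k sd, hv⟩

/-- **The link test from its parts** (second layer). [folklore] -/
theorem Slot2.linkB_intro {s s' : Slot2} (hred : PhaseQ2.redescribeB2 s.P true s'.P false s.rc s.rc' = true)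
    (h1 : s.P.t₀ + 2 * s.P.τ / 3 < s'.a) (h2 : s'.a < s'.P.t₀ + s'.P.τ / 3) (h3 : s.a ≤ s'.a) : Slot2.linkB s s' = true := by
  simp only [Slot2.linkB, hred, h1, h2, h3, decide_true, Bool.and_self]

end PlanarKinematics

end Literature.Analysis.FluidPDE
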